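import Mathlib
import Literature.RingTheory.HopfAlgebra.FiniteDualGroupLikePoints
import HarnessLib

/-!
# Naturality in `S` of «`G(S)` = group-like elements of `S ⊗_R B^*`»
(Tate, *Finite flat group schemes* (in Cornell–Silverman–Stevens 1997), §(3.8) «The dual Hopf algebra and Cartier duality»,
p. 145: «the same holds after base extension … for each `R`-algebra `B`» — the identification `G(B) =` group-likes of `A′_B` is
functorial in the `R`-algebra `B`; Montgomery, *Hopf algebras and their actions on rings*, CBMS 82 (1993), 9.1.4)

Topic `RingTheory/HopfAlgebra`; namespace `Literature.RingTheory.HopfAlgebra.FiniteDual`.  THEOREMS ONLY (no definition, no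
instance, no notation, no named fact, no `sorry`); imports ★ `FiniteDualGroupLikePoints` (F5) + Mathlib.  Cell `pub/hodgecm-mathlib`
(D-0151), FLOOR 0, programme F0P5a (crux item stmt-HodgeConjecture-24832; PLAN v4.1 §2 row H-CD «Cartier duality at `p`», KF8;
piece **CD1-nat** — the `G`-side companion of ★ CD2-pts §5 (naturality of «`G^D(S)` = group-likes of `S ⊗_R B`»), so that
`G ≅ (G^D)^D` is a statement about group FUNCTORS, as the scheme dress of Cartier duality needs) — road- and floor-independent;
changes no count.

SETTING (as F5).  `R` a commutative ring, `B` a finite free `R`-bialgebra, `h : S →ₐ[R] S'` a map of commutative `R`-algebras,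
`W := WithConv (Module.Dual R B)` with ★ F3's `FiniteDual.bialgebra R B` (installed by `letI` inside the statements), pairings
`Ψ : S ⊗[R] W → Hom_R(B, S)` and `Ψ' : S' ⊗[R] W → Hom_R(B, S')` with `Ψ (s ⊗ f) b = f b • s` (hypothesis style).  The base
change of group-like elements is `h ⊗ 1 = h.toLinearMap.rTensor W`; the map on points is `φ ↦ h ∘ φ`.

RESULTS:
* **`pointPairing_rTensor`** `: Ψ' ((h ⊗ 1) x) b = h (Ψ x b)` — the pairing is natural in `S`;
* **`isGroupLikeElem_baseChange_rTensor`** — base change along `h` carries group-like elements of `S ⊗_R B^*` to group-like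
  elements of `S' ⊗_R B^*` (finite free `B`; through F5's «group-like ⟺ algebra map»);
* **`pointPairing_rTensor_eq_comp`** — if `Ψ x = φ` then `Ψ' ((h ⊗ 1) x) = h ∘ φ`: the bijection `G(S) ≃ GroupLike_S (S ⊗ B^*)` of
  F5 intertwines `(h ⊗ 1)` with `G(h) : φ ↦ h ∘ φ`, i.e. it is a natural isomorphism of functors of commutative `R`-algebras;
  `rTensor_eq_of_algHom_comp` (the group-like of `h ∘ φ` IS `(h ⊗ 1)` of the group-like of `φ`).

HC_CM is proved only modulo the 7 printed citations until rung 0 closes; this file is generic algebra and changes no count.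

## References
* [Tate1997FiniteFlatGroupSchemes] J. Tate, *Finite flat group schemes*, in: Modular Forms and Fermat's Last Theorem (1997), §(3.8)
  p. 145.
* [Montgomery1993Hopf] S. Montgomery, *Hopf algebras and their actions on rings*, CBMS 82 (1993), 9.1.4.
-/

set_option autoImplicit false

noncomputable section

open TensorProduct Module WithConv

namespace Literature.RingTheory.HopfAlgebra

namespace FiniteDual

universe u v w w'

/-! ## §1 The pairing is natural in `S` -/

section Natural

variable {R : Type u} [CommRing R] {B : Type v} [AddCommMonoid B] [Module R B]
variable {S : Type w} [CommRing S] [Algebra R S] {S' : Type w'} [CommRing S'] [Algebra R S'] (h : S →ₐ[R] S')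
variable {Ψ : S ⊗[R] WithConv (Module.Dual R B) →ₗ[R] (B →ₗ[R] S)}
variable {Ψ' : S' ⊗[R] WithConv (Module.Dual R B) →ₗ[R] (B →ₗ[R] S')}

/-- **the pairing `S ⊗_R B^* → Hom_R(B, S)` is natural in `S`**: `Ψ' ((h ⊗ 1) x) b = h (Ψ x b)`.
[cite: Tate1997FiniteFlatGroupSchemes, §(3.8) p. 145] -/
theorem pointPairing_rTensor
    (hΨ : ∀ (s : S) (f : WithConv (Module.Dual R B)) (b : B), Ψ (s ⊗ₜ f) b = f b • s)
    (hΨ' : ∀ (s : S') (f : WithConv (Module.Dual R B)) (b : B), Ψ' (s ⊗ₜ f) b = f b • s)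
    (x : S ⊗[R] WithConv (Module.Dual R B)) (b : B) :
    Ψ' (h.toLinearMap.rTensor (WithConv (Module.Dual R B)) x) b = h (Ψ x b) := by
  induction x using TensorProduct.induction_on with
  | zero => simp
  | tmul s f => rw [LinearMap.rTensor_tmul, AlgHom.toLinearMap_apply, hΨ', hΨ, map_smul]
  | add x y hx hy => rw [map_add, map_add, LinearMap.add_apply, hx, hy, map_add, LinearMap.add_apply, map_add]

/-- the same, as an equality of linear maps: `Ψ' ((h ⊗ 1) x) = h ∘ Ψ x`. [cite: Tate1997FiniteFlatGroupSchemes, §(3.8) p. 145] -/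
theorem pointPairing_rTensor_eq
    (hΨ : ∀ (s : S) (f : WithConv (Module.Dual R B)) (b : B), Ψ (s ⊗ₜ f) b = f b • s)
    (hΨ' : ∀ (s : S') (f : WithConv (Module.Dual R B)) (b : B), Ψ' (s ⊗ₜ f) b = f b • s)
    (x : S ⊗[R] WithConv (Module.Dual R B)) :
    Ψ' (h.toLinearMap.rTensor (WithConv (Module.Dual R B)) x) = h.toLinearMap ∘ₗ Ψ x :=
  LinearMap.ext fun b => by rw [pointPairing_rTensor h hΨ hΨ', LinearMap.comp_apply, AlgHom.toLinearMap_apply]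

end Natural

/-! ## §2 Base change of group-like elements ↔ composition of points -/

section GroupLike

variable {R : Type u} [CommRing R] {B : Type v} [Semiring B] [Bialgebra R B] [Module.Free R B] [Module.Finite R B]
variable {S : Type w} [CommRing S] [Algebra R S] {S' : Type w'} [CommRing S'] [Algebra R S'] (h : S →ₐ[R] S')
variable {Ψ : S ⊗[R] WithConv (Module.Dual R B) →ₗ[R] (B →ₗ[R] S)}
variable {Ψ' : S' ⊗[R] WithConv (Module.Dual R B) →ₗ[R] (B →ₗ[R] S')}

omit [Module.Free R B] [Module.Finite R B] in
/-- **if `Ψ x = φ` then `Ψ' ((h ⊗ 1) x) = h ∘ φ`**: base change of group-like elements is composition of points («`G(h)`»).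
[cite: Tate1997FiniteFlatGroupSchemes, §(3.8) p. 145] -/
theorem pointPairing_rTensor_eq_comp
    (hΨ : ∀ (s : S) (f : WithConv (Module.Dual R B)) (b : B), Ψ (s ⊗ₜ f) b = f b • s)
    (hΨ' : ∀ (s : S') (f : WithConv (Module.Dual R B)) (b : B), Ψ' (s ⊗ₜ f) b = f b • s)
    {x : S ⊗[R] WithConv (Module.Dual R B)} (φ : B →ₐ[R] S) (hx : Ψ x = φ.toLinearMap) :
    Ψ' (h.toLinearMap.rTensor (WithConv (Module.Dual R B)) x) = (h.comp φ).toLinearMap := by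
  rw [pointPairing_rTensor_eq h hΨ hΨ', hx]
  rfl

/-- **base change preserves group-like elements** of `S ⊗_R B^*` (finite free `B`): if `x` is `S`-group-like then `(h ⊗ 1) x` is
`S'`-group-like — the point of `x` composed with `h` is again an algebra map. [cite: Tate1997FiniteFlatGroupSchemes, §(3.8) p. 145] -/
theorem isGroupLikeElem_baseChange_rTensor
    (hΨ : ∀ (s : S) (f : WithConv (Module.Dual R B)) (b : B), Ψ (s ⊗ₜ f) b = f b • s)
    (hΨ' : ∀ (s : S') (f : WithConv (Module.Dual R B)) (b : B), Ψ' (s ⊗ₜ f) b = f b • s)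
    {x : S ⊗[R] WithConv (Module.Dual R B)}
    (hx : letI : Bialgebra R (WithConv (Module.Dual R B)) := FiniteDual.bialgebra R B; IsGroupLikeElem S x) :
    letI : Bialgebra R (WithConv (Module.Dual R B)) := FiniteDual.bialgebra R B
    IsGroupLikeElem S' (h.toLinearMap.rTensor (WithConv (Module.Dual R B)) x) := by
  obtain ⟨φ, hφ, -⟩ := existsUnique_algHom_of_isGroupLikeElem_baseChange hΨ hx
  exact isGroupLikeElem_baseChange_of_eq_algHom hΨ' (h.comp φ) (pointPairing_rTensor_eq_comp h hΨ hΨ' φ hφ.symm)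

/-- **the group-like element of `h ∘ φ` is `(h ⊗ 1)` of the group-like element of `φ`** (the squares of F5's bijection commute:
a natural isomorphism `G ≅ GroupLike_(·) ((·) ⊗_R B^*)` of functors on commutative `R`-algebras).
[cite: Tate1997FiniteFlatGroupSchemes, §(3.8) p. 145] -/
theorem rTensor_eq_of_algHom_comp
    (hΨ : ∀ (s : S) (f : WithConv (Module.Dual R B)) (b : B), Ψ (s ⊗ₜ f) b = f b • s)
    (hΨ' : ∀ (s : S') (f : WithConv (Module.Dual R B)) (b : B), Ψ' (s ⊗ₜ f) b = f b • s)
    (φ : B →ₐ[R] S) {x : S ⊗[R] WithConv (Module.Dual R B)} {x' : S' ⊗[R] WithConv (Module.Dual R B)}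
    (hx : letI : Bialgebra R (WithConv (Module.Dual R B)) := FiniteDual.bialgebra R B; IsGroupLikeElem S x)
    (hxφ : Ψ x = φ.toLinearMap)
    (hx' : letI : Bialgebra R (WithConv (Module.Dual R B)) := FiniteDual.bialgebra R B; IsGroupLikeElem S' x')
    (hx'φ : Ψ' x' = (h.comp φ).toLinearMap) :
    x' = h.toLinearMap.rTensor (WithConv (Module.Dual R B)) x :=
  eq_of_isGroupLikeElem_baseChange_of_pointPairing_eq hΨ' hx' (isGroupLikeElem_baseChange_rTensor h hΨ hΨ' hx)
    (by rw [hx'φ, pointPairing_rTensor_eq_comp h hΨ hΨ' φ hxφ])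

end GroupLike

end FiniteDual

end Literature.RingTheory.HopfAlgebra

end
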